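import Summits.CriticalPhenomena.PercolationContinuityZ3.Theorems.Transplant.FKDoubleFanOneSidedProducts
import Summits.CriticalPhenomena.PercolationContinuityZ3.Theorems.Transplant.FKDoubleFanCrossApexInKE
import HarnessLib

/-!
# Double fans, one-sided far pairs: the RAY DECOMPOSITION of the three legs of LEMMA′ (generic floor/roof method with polynomial roof points)

Helper file (`--supports stmt-CriticalPhenomena-4575`), FK sub-lane `prim-bschramm-fk-3` (gen 32); builds on p205010 (kernel theorem, internal audit
signed; external expert review pending).  Pure real algebra, no sorries; standard axioms.  Memo `bschramm/prim-bschramm-fk-3/FAR-CROSS-VII.md` §1.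

LEMMA′ (`fanPhi q F u s ≥ 0` for `F ∈ Valid ∧ U_c`, `u ∈ Valid ∧ U_b`, `s ∈ Valid ∧ U_a`) is attacked leg by leg with the floor/roof method of
`…CrossApexInKE`.  This file provides the method ONCE, for an arbitrary functional `Φ : V5 → ℝ` that is affine along the apex-`b` fibre
(`vecB_nonneg_of_rays_gen`, `nonneg_of_rays_gen`), with the roof points delivered in the POLYNOMIAL parametrisation `roofV` of `…OneSidedProducts`
(**`exists_roof_param`**: every `U`-tight point with tight probe `w` — direction relation + tightness relation of `…CrossApexRoof` — is a `roofV q κ l t w`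
with `κ ≥ 0`, `l = W − qy > 0`, `t = y/l ≥ 0`).  The endpoints of a leg are: the degenerate frame `vecB q (qy) y 0 0 u₀`, the FLOOR points
`vecB q W y X Z 0` (with `Z_1 ≥ 0`), and the ROOF points `roofV`.  The three specialisations **`fanPhi_legB_nonneg`** (`u`, apex `b`),
**`fanPhi_legA_nonneg`** (`s = swapAB v`, apex `a`), **`fanPhi_legC_nonneg`** (`F = swapAC (swapAB v)`, apex `c` of the fan triple) take masses `≥ 0` and
the corresponding `U`-condition only.
[folklore]
-/

noncomputable section

namespace Summit.CriticalPhenomena.PercolationContinuityZ3.Theorems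

namespace FK

namespace ThreeApex

/-! ### Every roof point is a polynomial roof point -/

/-- **Every roof point is a `roofV`.**  From the direction relation and the tightness relation (`q·y < W`, `0 ≤ q < 1`, masses `≥ 0`,
`w ∈ [0,1]`): `vecB q W y X Z u₀ = roofV q κ l t w` with `κ = (X+Z)/(xw+zw) ≥ 0`, `l = W − qy > 0`, `t = y/l ≥ 0`. [folklore] -/
theorem exists_roof_param {q W y X Z u0 w : ℝ} (hq0 : 0 ≤ q) (hq1 : q < 1) (hW : q * y < W) (hy : 0 ≤ y) (hX : 0 ≤ X) (hZ : 0 ≤ Z)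
    (hw0 : 0 ≤ w) (hw1 : w ≤ 1)
    (hR : q * (X - Z) * w ^ 2 + 2 * ((1 - q) * X + Z) * w - (2 - q) * Z = 0)
    (hT : (u0 * (W - q * y) - (X + Z) * y) * ((1 - q) + q * w * (1 - w)) = W * (w ^ 2 * X + (1 - w) ^ 2 * Z)) :
    ∃ κ l t : ℝ, 0 ≤ κ ∧ 0 < l ∧ 0 ≤ t ∧ vecB q W y X Z u0 = roofV q κ l t w := by
  have hl : 0 < W - q * y := sub_pos.2 hW
  have hs := xwR_add_zwR_pos (w := w) hq0 hq1
  have hN : 0 < (1 - q) + q * w * (1 - w) := probeN_pos hq0 hq1 hw0 hw1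
  rw [dirRel_eq] at hR
  refine ⟨(X + Z) / (xwR q w + zwR q w), W - q * y, y / (W - q * y), div_nonneg (add_nonneg hX hZ) hs.le, hl,
    div_nonneg hy hl.le, ?_⟩
  have ht : (W - q * y) * (y / (W - q * y)) = y := mul_div_cancel₀ _ hl.ne'
  have hκx : (X + Z) / (xwR q w + zwR q w) * xwR q w = X := by
    rw [div_mul_eq_mul_div, div_eq_iff hs.ne']; linear_combination (-1 : ℝ) * hR
  have hκz : (X + Z) / (xwR q w + zwR q w) * zwR q w = Z := by
    rw [div_mul_eq_mul_div, div_eq_iff hs.ne']; linear_combination hR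
  -- the fibre coordinate: cancel `N(w) > 0` in the tightness relation
  have hD : w ^ 2 * X + (1 - w) ^ 2 * Z = (X + Z) / (xwR q w + zwR q w) * (2 * w * (1 - w) * ((1 - q) + q * w * (1 - w))) := by
    have e := dProfile_eq q w
    calc w ^ 2 * X + (1 - w) ^ 2 * Z
        = w ^ 2 * ((X + Z) / (xwR q w + zwR q w) * xwR q w) + (1 - w) ^ 2 * ((X + Z) / (xwR q w + zwR q w) * zwR q w) := by
          rw [hκx, hκz]
      _ = (X + Z) / (xwR q w + zwR q w) * (w ^ 2 * xwR q w + (1 - w) ^ 2 * zwR q w) := by ring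
      _ = _ := by rw [e]
  have hu0 : u0 * (W - q * y) = (X + Z) * y + W * ((X + Z) / (xwR q w + zwR q w) * (2 * w * (1 - w))) := by
    have h2 : (u0 * (W - q * y) - (X + Z) * y) * ((1 - q) + q * w * (1 - w)) =
        (W * ((X + Z) / (xwR q w + zwR q w) * (2 * w * (1 - w)))) * ((1 - q) + q * w * (1 - w)) := by
      rw [hT, hD]; ring
    have := mul_right_cancel₀ hN.ne' h2
    linarith
  have hκs : (X + Z) / (xwR q w + zwR q w) * (xwR q w + zwR q w) = X + Z := div_mul_cancel₀ _ hs.ne'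
  have key : u0 * (W - q * y) = (X + Z) / (xwR q w + zwR q w) * ((2 - q) * y + 2 * w * (1 - w) * (W - q * y)) := by
    rw [hu0]
    have e2 : (X + Z) * y = (X + Z) / (xwR q w + zwR q w) * (xwR q w + zwR q w) * y := by rw [hκs]
    rw [e2, xwR_add_zwR]; ring
  have hu0' : u0 = (X + Z) / (xwR q w + zwR q w) * ((2 - q) * (y / (W - q * y)) + 2 * w * (1 - w)) := by
    have e4 : (X + Z) / (xwR q w + zwR q w) * ((2 - q) * (y / (W - q * y)) + 2 * w * (1 - w)) =
        ((X + Z) / (xwR q w + zwR q w) * ((2 - q) * y + 2 * w * (1 - w) * (W - q * y))) / (W - q * y) := by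
      field_simp
    rw [e4, ← key, mul_div_cancel_right₀ _ hl.ne']
  ext
  · simp only [roofV, vecB, u0R]; exact hu0'
  · simp only [roofV, vecB]; rw [hκx]
  · simp only [roofV, vecB, u0R]; rw [ht, hu0']
  · simp only [roofV, vecB]; rw [hκz]
  · simp only [roofV, vecB]
    rw [hκx, hκz, ht]
    have e3 : (W - q * y) * (1 + q * (y / (W - q * y))) = W := by
      rw [mul_add, mul_one, ← mul_assoc, mul_comm (W - q * y) q, mul_assoc, ht]; ring
    rw [e3]

/-! ### The generic ray decomposition -/

/-- **Generic ray decomposition in the apex-`b` frame.**  Let `Φ` be affine along the fibre coordinate `u₀`.  If `Φ ≥ 0` on the degenerate frame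
`vecB q (qy) y 0 0 u₀` (`0 ≤ u₀ ≤ y`), on every floor point `vecB q W y X Z 0` (`X, Z, y ≥ 0`, `qy < W`, `Z_1 ≥ 0`) and on every roof point
`roofV q κ l t w` (`κ, t ≥ 0`, `l > 0`, `w ∈ [0,1]`), then `Φ ≥ 0` at every point with masses `≥ 0` satisfying `(U_b)` in coordinates
(`0 < q < 1`). [folklore] -/
theorem vecB_nonneg_of_rays_gen {q : ℝ} (hq0 : 0 < q) (hq1 : q < 1) {Φ : V5 → ℝ}
    (haff : ∀ W y X Z a b c : ℝ,
      Φ (vecB q W y X Z (c * a + (1 - c) * b)) = c * Φ (vecB q W y X Z a) + (1 - c) * Φ (vecB q W y X Z b))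
    (hdeg : ∀ y u0 : ℝ, 0 ≤ u0 → u0 ≤ y → 0 ≤ Φ (vecB q (q * y) y 0 0 u0))
    (hfloor : ∀ W y X Z : ℝ, 0 ≤ X → 0 ≤ Z → 0 ≤ y → q * y < W → 0 ≤ W - q * y - X - Z → 0 ≤ Φ (vecB q W y X Z 0))
    (hroof : ∀ κ l t w : ℝ, 0 ≤ κ → 0 < l → 0 ≤ t → 0 ≤ w → w ≤ 1 → 0 ≤ Φ (roofV q κ l t w))
    {W y X Z u0 : ℝ} (hX : 0 ≤ X) (hZ : 0 ≤ Z) (hu0 : 0 ≤ u0) (hyu : u0 ≤ y) (h1 : 0 ≤ W - q * y - X - Z)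
    (hUb : ∀ w : ℝ, 0 ≤ w → w ≤ 1 →
      (u0 * (W - q * y) - (X + Z) * y) * ((1 - q) + q * w * (1 - w)) ≤ W * (w ^ 2 * X + (1 - w) ^ 2 * Z)) :
    0 ≤ Φ (vecB q W y X Z u0) := by
  have hy0 : 0 ≤ y := hu0.trans hyu
  rcases eq_or_lt_of_le (show q * y ≤ W by linarith) with hW | hW
  · -- degenerate frame: `X = Z = Z_1 = 0`
    have hX0 : X = 0 := by linarith
    have hZ0 : Z = 0 := by linarith
    subst hX0 hZ0 hW
    exact hdeg y u0 hu0 hyu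
  · -- the tight probe from the intermediate value theorem
    obtain ⟨w, ⟨hw0, hw1⟩, hRw⟩ : ∃ w ∈ Set.Icc (0:ℝ) 1,
        (fun w : ℝ => q * (X - Z) * w ^ 2 + 2 * ((1 - q) * X + Z) * w - (2 - q) * Z) w = 0 := by
      have hc : ContinuousOn (fun w : ℝ => q * (X - Z) * w ^ 2 + 2 * ((1 - q) * X + Z) * w - (2 - q) * Z) (Set.Icc 0 1) := by
        fun_prop
      refine intermediate_value_Icc zero_le_one hc ⟨?_, ?_⟩
      · have : 0 ≤ (2 - q) * Z := by nlinarith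
        show q * (X - Z) * 0 ^ 2 + 2 * ((1 - q) * X + Z) * 0 - (2 - q) * Z ≤ 0
        nlinarith
      · have : 0 ≤ (2 - q) * X := by nlinarith
        show 0 ≤ q * (X - Z) * 1 ^ 2 + 2 * ((1 - q) * X + Z) * 1 - (2 - q) * Z
        nlinarith
    have hN : 0 < (1 - q) + q * w * (1 - w) := probeN_pos hq0.le hq1 hw0 hw1
    have hWq : 0 < W - q * y := by linarith
    have hden : (W - q * y) * ((1 - q) + q * w * (1 - w)) ≠ 0 := (mul_pos hWq hN).ne'
    -- the roof value above `(X, Z)`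
    obtain ⟨uR, huR⟩ : ∃ uR : ℝ, uR = ((X + Z) * y * ((1 - q) + q * w * (1 - w)) + W * (w ^ 2 * X + (1 - w) ^ 2 * Z)) /
        ((W - q * y) * ((1 - q) + q * w * (1 - w))) := ⟨_, rfl⟩
    have hmul : uR * ((W - q * y) * ((1 - q) + q * w * (1 - w))) =
        (X + Z) * y * ((1 - q) + q * w * (1 - w)) + W * (w ^ 2 * X + (1 - w) ^ 2 * Z) := by
      rw [huR]; exact div_mul_cancel₀ _ hden
    have hT : (uR * (W - q * y) - (X + Z) * y) * ((1 - q) + q * w * (1 - w)) = W * (w ^ 2 * X + (1 - w) ^ 2 * Z) := by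
      linear_combination hmul
    have hle : u0 ≤ uR := by
      by_contra hc
      have hc := not_le.1 hc
      have h2 : (uR * (W - q * y) - (X + Z) * y) * ((1 - q) + q * w * (1 - w)) <
          (u0 * (W - q * y) - (X + Z) * y) * ((1 - q) + q * w * (1 - w)) :=
        mul_lt_mul_of_pos_right (by nlinarith [mul_lt_mul_of_pos_right hc hWq]) hN
      linarith [hUb w hw0 hw1]
    have huR0 : 0 ≤ uR := hu0.trans hle
    have hfl := hfloor W y X Z hX hZ hy0 hW h1
    rcases eq_or_lt_of_le huR0 with hR0 | hRpos
    · have hu00 : u0 = 0 := le_antisymm (hR0 ▸ hle) hu0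
      rw [hu00]; exact hfl
    · obtain ⟨κ, l, t, hκ, hl, ht, hv⟩ := exists_roof_param hq0.le hq1 hW hy0 hX hZ hw0 hw1 hRw hT
      have hrf : 0 ≤ Φ (vecB q W y X Z uR) := by rw [hv]; exact hroof κ l t w hκ hl ht hw0 hw1
      have hsplit : u0 = u0 / uR * uR + (1 - u0 / uR) * 0 := by
        rw [mul_zero, add_zero, div_mul_cancel₀ _ hRpos.ne']
      rw [hsplit, haff]
      have hc1 : u0 / uR ≤ 1 := (div_le_one hRpos).2 hle
      have := sub_nonneg.2 hc1
      exact add_nonneg (mul_nonneg (div_nonneg hu0 huR0) hrf) (mul_nonneg this hfl)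

/-- `(U_b)` in coordinates: for `Z` with `UCond q (swapAB Z)`, the fibre inequality `I_b·N(w) ≤ W·D(w)` for every `w ∈ [0,1]`
(`W = |Z| − (1−q)(Z_0+Z_ac)`, `y = Z_0 + Z_ac`, `X = Z_ab`, `Z = Z_bc`, `u₀ = Z_0`). [folklore] -/
theorem uCondB_coord {q : ℝ} {Z : V5} (hU : UCond q (swapAB Z)) (w : ℝ) (hw0 : 0 ≤ w) (hw1 : w ≤ 1) :
    (Z.z0 * ((Z.total - (1 - q) * (Z.z0 + Z.zac)) - q * (Z.z0 + Z.zac)) - (Z.zab + Z.zbc) * (Z.z0 + Z.zac)) *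
        ((1 - q) + q * w * (1 - w)) ≤ (Z.total - (1 - q) * (Z.z0 + Z.zac)) * (w ^ 2 * Z.zab + (1 - w) ^ 2 * Z.zbc) := by
  have h := hU w (1 - w) hw0 (sub_nonneg.2 hw1)
  rw [uForm_eq_wlin] at h
  simp only [wlin, jA_eq, swapAB, V5.total] at h ⊢
  nlinarith [h]

/-- **Generic ray decomposition for a vector with masses `≥ 0` and `(U_b)`.** [folklore] -/
theorem nonneg_of_rays_gen {q : ℝ} (hq0 : 0 < q) (hq1 : q < 1) {Φ : V5 → ℝ}
    (haff : ∀ W y X Z a b c : ℝ,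
      Φ (vecB q W y X Z (c * a + (1 - c) * b)) = c * Φ (vecB q W y X Z a) + (1 - c) * Φ (vecB q W y X Z b))
    (hdeg : ∀ y u0 : ℝ, 0 ≤ u0 → u0 ≤ y → 0 ≤ Φ (vecB q (q * y) y 0 0 u0))
    (hfloor : ∀ W y X Z : ℝ, 0 ≤ X → 0 ≤ Z → 0 ≤ y → q * y < W → 0 ≤ W - q * y - X - Z → 0 ≤ Φ (vecB q W y X Z 0))
    (hroof : ∀ κ l t w : ℝ, 0 ≤ κ → 0 < l → 0 ≤ t → 0 ≤ w → w ≤ 1 → 0 ≤ Φ (roofV q κ l t w))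
    {Z : V5} (hZ : Z.Nonneg) (hU : UCond q (swapAB Z)) : 0 ≤ Φ Z := by
  obtain ⟨h0, hab, hac, hbc, h1⟩ := hZ
  have key := vecB_nonneg_of_rays_gen hq0 hq1 haff hdeg hfloor hroof (W := Z.total - (1 - q) * (Z.z0 + Z.zac))
    (y := Z.z0 + Z.zac) hab hbc h0 (by linarith) (by simp only [V5.total]; linarith) (by
      intro w hw0 hw1
      have := uCondB_coord hU w hw0 hw1
      linarith)
  rwa [vecB_eta] at key

/-! ### The three legs of `fanPhi` -/

/-- Affinity of `fanPhi` along `u₀` (leg `u`). [folklore] -/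
theorem fanPhi_u0_affine (q W y X Z a b c : ℝ) (F s : V5) :
    fanPhi q F (vecB q W y X Z (c * a + (1 - c) * b)) s =
      c * fanPhi q F (vecB q W y X Z a) s + (1 - c) * fanPhi q F (vecB q W y X Z b) s := by
  simp only [fanPhi, vecB, hx, hy, hz, V5.total]; ring

/-- Affinity of `fanPhi` along `s₀` (leg `s`). [folklore] -/
theorem fanPhi_s0_affine (q W z X Y a b c : ℝ) (F u : V5) :
    fanPhi q F u (swapAB (vecB q W z X Y (c * a + (1 - c) * b))) =
      c * fanPhi q F u (swapAB (vecB q W z X Y a)) + (1 - c) * fanPhi q F u (swapAB (vecB q W z X Y b)) := by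
  simp only [fanPhi, vecB, swapAB, hx, hy, hz, V5.total]; ring

/-- `swapAC` is an involution. [folklore] -/
theorem swapAC_swapAC (Z : V5) : swapAC (swapAC Z) = Z := by ext <;> rfl

/-- **Leg `u` (apex `b`).**  If `fanPhi q F · s ≥ 0` on the degenerate frame, the floor points and the roof points of the apex-`b` frame, then
`fanPhi q F u s ≥ 0` for every `u` with masses `≥ 0` and `(U_b)` (`0 < q < 1`). [folklore] -/
theorem fanPhi_legB_nonneg {q : ℝ} (hq0 : 0 < q) (hq1 : q < 1) {F s : V5}
    (hdeg : ∀ y u0 : ℝ, 0 ≤ u0 → u0 ≤ y → 0 ≤ fanPhi q F (vecB q (q * y) y 0 0 u0) s)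
    (hfloor : ∀ W y X Z : ℝ, 0 ≤ X → 0 ≤ Z → 0 ≤ y → q * y < W → 0 ≤ W - q * y - X - Z → 0 ≤ fanPhi q F (vecB q W y X Z 0) s)
    (hroof : ∀ κ l t w : ℝ, 0 ≤ κ → 0 < l → 0 ≤ t → 0 ≤ w → w ≤ 1 → 0 ≤ fanPhi q F (roofV q κ l t w) s)
    {u : V5} (hu : u.Nonneg) (hU : UCond q (swapAB u)) : 0 ≤ fanPhi q F u s :=
  nonneg_of_rays_gen hq0 hq1 (Φ := fun v => fanPhi q F v s) (fun W y X Z a b c => fanPhi_u0_affine q W y X Z a b c F s)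
    hdeg hfloor hroof hu hU

/-- **Leg `s` (apex `a`).**  Same with `s = swapAB v`, `v` in the apex-`b` frame; hypothesis `(U_a)(s)`. [folklore] -/
theorem fanPhi_legA_nonneg {q : ℝ} (hq0 : 0 < q) (hq1 : q < 1) {F u : V5}
    (hdeg : ∀ y u0 : ℝ, 0 ≤ u0 → u0 ≤ y → 0 ≤ fanPhi q F u (swapAB (vecB q (q * y) y 0 0 u0)))
    (hfloor : ∀ W y X Z : ℝ, 0 ≤ X → 0 ≤ Z → 0 ≤ y → q * y < W → 0 ≤ W - q * y - X - Z →
      0 ≤ fanPhi q F u (swapAB (vecB q W y X Z 0)))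
    (hroof : ∀ κ l t w : ℝ, 0 ≤ κ → 0 < l → 0 ≤ t → 0 ≤ w → w ≤ 1 → 0 ≤ fanPhi q F u (swapAB (roofV q κ l t w)))
    {s : V5} (hs : s.Nonneg) (hU : UCond q s) : 0 ≤ fanPhi q F u s := by
  have hv : (swapAB s).Nonneg := by obtain ⟨h0, h1, h2, h3, h4⟩ := hs; exact ⟨h0, h1, h3, h2, h4⟩
  have hU' : UCond q (swapAB (swapAB s)) := by rwa [swapAB_swapAB]
  have := nonneg_of_rays_gen hq0 hq1 (Φ := fun v => fanPhi q F u (swapAB v))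
    (fun W y X Z a b c => fanPhi_s0_affine q W y X Z a b c F u) hdeg hfloor hroof hv hU'
  simpa only [swapAB_swapAB] using this

/-- **Leg `F` (apex `c` of the fan triple).**  Same with `F = swapAC (swapAB v)`; hypothesis `(U_c)(F)`. [folklore] -/
theorem fanPhi_legC_nonneg {q : ℝ} (hq0 : 0 < q) (hq1 : q < 1) {u s : V5}
    (hdeg : ∀ y u0 : ℝ, 0 ≤ u0 → u0 ≤ y → 0 ≤ fanPhi q (swapAC (swapAB (vecB q (q * y) y 0 0 u0))) u s)
    (hfloor : ∀ W y X Z : ℝ, 0 ≤ X → 0 ≤ Z → 0 ≤ y → q * y < W → 0 ≤ W - q * y - X - Z →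
      0 ≤ fanPhi q (swapAC (swapAB (vecB q W y X Z 0))) u s)
    (hroof : ∀ κ l t w : ℝ, 0 ≤ κ → 0 < l → 0 ≤ t → 0 ≤ w → w ≤ 1 → 0 ≤ fanPhi q (swapAC (swapAB (roofV q κ l t w))) u s)
    {F : V5} (hF : F.Nonneg) (hU : UCond q (swapAC F)) : 0 ≤ fanPhi q F u s := by
  have hv : (swapAB (swapAC F)).Nonneg := by obtain ⟨h0, h1, h2, h3, h4⟩ := hF; exact ⟨h0, h3, h1, h2, h4⟩
  have hU' : UCond q (swapAB (swapAB (swapAC F))) := by rwa [swapAB_swapAB]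
  have := nonneg_of_rays_gen hq0 hq1 (Φ := fun v => fanPhi q (swapAC (swapAB v)) u s)
    (fun W y X Z a b c => by simp only [fanPhi, vecB, swapAB, swapAC, hx, hy, hz, V5.total]; ring) hdeg hfloor hroof hv hU'
  simpa only [swapAB_swapAB, swapAC_swapAC] using this

end ThreeApex

end FK

end Summit.CriticalPhenomena.PercolationContinuityZ3.Theorems
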